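import Literature.AlgebraicGeometry.HodgeTheory.ComplexGysinRational
import Literature.AlgebraicGeometry.Motives.ComplexPointsSubmersion
import Literature.AlgebraicTopology.SingularHomology.PositiveAtlasOrientation
import Literature.AlgebraicTopology.SingularHomology.LocalDegreeSum
import Literature.AlgebraicTopology.SingularHomology.OrientationProofs
import Literature.AlgebraicTopology.SingularHomology.GysinMapOrientationChange
import Literature.AlgebraicTopology.SingularHomology.PoincareDualityProofs
import Literature.Topology.FourManifolds.ComplexProjectiveSpaceOrientationProofs
import HarnessLib

/-!
# The complex orientation family: `X(ℂ)` oriented by its holomorphic algebraic atlas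

Family `hodge`, layer `Literature/AlgebraicGeometry/HodgeTheory`. The Gysin morphisms
`complexGysin μ` (`HodgeTheory/ComplexGysin`) and the cycle classes `cycleClass μ`
(`HodgeTheory/CycleClassOfResolutions`) are defined for an ARBITRARY orientation family `μ` (a
`ℂ`-orientation of each closed `2n`-manifold `X(ℂ)`), and the tree so far only knew that orientations
EXIST (`Motives.ComplexPoints.isOrientableOver`: "which of the two orientations of a connected `X(ℂ)` is
'the complex one' is not tracked"). The classical identities between cycle classes — Fulton's degree
formula `g_* 1_V = deg(V/W) [W]` (Lemma 19.1.2), Voisin's Lemma 9.18 — hold for the COMPLEX orientations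
and fail for a general family (rescale the orientation of one `V(ℂ)`). This file pins the family:

* `isPositiveAtlas_complexPoints` — **the atlas of holomorphic algebraic charts of `X(ℂ)` is positive**
  (`X` smooth projective; the charts `IsSmoothProjective.chartedSpace` are Serre's algebraic charts
  followed by a fixed real-linear `ℂⁿ ≃ ℝ²ⁿ`, GAGA §2 n°5 Prop. 2; their changes are holomorphic with
  invertible differential, so the real Jacobian determinants are `|det_ℂ|² > 0` — Milnor–Stasheff §13
  p. 151 "every complex manifold has a preferred orientation", Huybrechts Cor. 1.2.3; the computation is
  the tree's `det_restrictScalars_eq_normSq`, `det_conj_continuousLinearEquiv`);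
* `complexOrientationInt hX : HomologicalOrientation ℤ X(ℂ) (2n)` — **the complex orientation**, the
  `ℤ`-orientation of the positive atlas (`positiveAtlasOrientation`, Bredon VI.7), relative to a fixed
  generator `euclideanGenerator (2n)` of `H_{2n}(ℝ²ⁿ | 0; ℤ)`: this is the complex orientation of
  Voisin I §11.1.2 up to a sign `ε(n) = ±1` depending ONLY on `n` (the convention hidden in the fixed
  `ℂⁿ ≃ ℝ²ⁿ` and the fixed generator), a normalisation under which every identity between Gysin images
  `V(ℂ) → X(ℂ)` with `dim V`, `dim X` fixed is unchanged;
* `complexOrientationFamily : OrientationFamily` — its complexification: the `ℂ`-orientation of `X(ℂ)`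
  whose fundamental class is `ι_*[X(ℂ)]`, `ι : ℚ → ℂ`, for the rational complex orientation
  (`fundamentalClass_complexOrientationFamily`; built by rescaling an auxiliary `ℂ`-orientation, Hatcher
  Thm. 3.26, as the tree's rationally normalised families);
* `exists_coeffChange_fundamentalClass_eq_complexOrientationFamily` — hence the family HAS RATIONAL
  FUNDAMENTAL CLASSES (the hypothesis `OrientationFamily.HasRationalFundamentalClasses` of
  `HodgeTheory/CycleClassOfResolutions`, under which `complexGysin` preserves rational classes).

Also: `HomologicalOrientation.unitSmul` (rescaling an orientation by a unit) with
`fundamentalClass_unitSmul`, declared by their absolute names into the structure's namespace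
`Literature.AlgebraicTopology.SingularHomology.HomologicalOrientation` for dot notation.

Not here: that holomorphic maps have local degree `+1` for these orientations (Fulton Lemma 19.1.2 /
Milnor–Stasheff §13), i.e. the degree formula and Lemma 9.18 for `complexOrientationFamily` — named
facts of the consumers.

## References

* [MilnorStasheff1974] J. Milnor, J. Stasheff, Characteristic Classes, PUP 1974, §13 p. 151, App. A.
* [HuybrechtsCG2005] D. Huybrechts, Complex Geometry, Springer 2005, Cor. 1.2.3.
* [SerreGAGA1956] J.-P. Serre, GAGA, Ann. Inst. Fourier 6 (1956), §2 n°5 Prop. 2.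
* [Bredon1993] G. E. Bredon, Topology and Geometry, GTM 139, Springer 1993, VI.7.
* [HatcherAT2002] A. Hatcher, Algebraic Topology, CUP 2002, §3.3 p. 235, Thm. 3.26.
* [VoisinHodgeI2002] C. Voisin, Hodge Theory and Complex Algebraic Geometry I, CUP 2002, §11.1.2, §7.3.2.
-/

noncomputable section

open scoped ContDiff Topology
open CategoryTheory AlgebraicGeometry Set Filter
open Literature.AlgebraicTopology.SingularHomology Literature.Topology.FourManifolds

universe u v

/-! ### Rescaling an orientation by a unit -/

namespace Literature.AlgebraicTopology.SingularHomology.HomologicalOrientation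

variable {R : Type v} [CommRing R] {M : Type u} [TopologicalSpace M] {d : ℕ}

/-- The orientation `x ↦ u • μₓ` for a unit `u` ("an `R`-orientation … a generator of
`Hₙ(M | x; R)`": unit multiples of generators are generators). Declared into the namespace of
`HomologicalOrientation` (`AlgebraicTopology/SingularHomology/Orientation`) for dot notation.
[cite: HatcherAT2002, §3.3 p. 235] -/
def unitSmul (u : Rˣ) (μ : HomologicalOrientation R M d) : HomologicalOrientation R M d where
  localClass x := (u : R) • μ.localClass x
  isGenerator x := by
    obtain ⟨e, he⟩ := μ.isGenerator x
    refine ⟨e.trans (DistribMulAction.toLinearEquiv R R u⁻¹), ?_⟩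
    simp [he, Units.smul_def]
  locallyConsistent x := by
    obtain ⟨K, hK, μK, hμK⟩ := μ.locallyConsistent x
    exact ⟨K, hK, (u : R) • μK, fun y hy ↦ by rw [map_smul, hμK y hy]⟩

/-- `(u • μ)ₓ = u • μₓ`. [cite: HatcherAT2002, §3.3 p. 235] -/
@[simp]
theorem unitSmul_localClass (u : Rˣ) (μ : HomologicalOrientation R M d) (x : M) :
    (μ.unitSmul u).localClass x = (u : R) • μ.localClass x := rfl

/-- `[M]_{u • μ} = u • [M]_μ` on a closed connected manifold (both are fundamental classes restricting
to `u • μₓ`; Hatcher Thm. 3.26). [cite: HatcherAT2002, §3.3 Thm. 3.26] -/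
theorem fundamentalClass_unitSmul [CompactSpace M] [T2Space M]
    [ChartedSpace (EuclideanSpace ℝ (Fin d)) M] [ConnectedSpace M] (u : Rˣ)
    (μ : HomologicalOrientation R M d) :
    (μ.unitSmul u).fundamentalClass = (u : R) • μ.fundamentalClass := by
  obtain ⟨u', hu', hloc⟩ := μ.exists_unit_fundamentalClass_eq_smul (μ.unitSmul u)
  obtain ⟨x₀⟩ := (inferInstance : Nonempty M)
  obtain ⟨e, he⟩ := μ.isGenerator x₀
  have h1 := hloc x₀
  rw [unitSmul_localClass] at h1
  have h2 := congrArg e h1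
  rw [map_smul, map_smul, he, smul_eq_mul, smul_eq_mul, mul_one, mul_one] at h2
  rw [hu', ← h2]

end Literature.AlgebraicTopology.SingularHomology.HomologicalOrientation

namespace Literature.AlgebraicGeometry.HodgeTheory

section HodgeTheory

variable {n : ℕ} {X : Motives.SchemeOver ℂ}

/-! ### The holomorphic algebraic atlas of `X(ℂ)` is positive -/

/-- The fixed real-linear identification `ℂⁿ ≃L[ℝ] ℝ²ⁿ` underlying the charts of
`Motives.ComplexPoints.chartedSpace` (`Motives.complexToEuclidean n` is its homeomorphism).
[folklore] -/
def complexToEuclideanCLE (n : ℕ) : (Fin n → ℂ) ≃L[ℝ] EuclideanSpace ℝ (Fin (2 * n)) :=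
  ContinuousLinearEquiv.ofFinrankEq (𝕜 := ℝ) (by
    rw [Module.finrank_pi_fintype, finrank_euclideanSpace_fin]
    simp [Complex.finrank_real_complex, mul_comm])

/-- `Motives.complexToEuclidean n` is the homeomorphism of `complexToEuclideanCLE n`. [folklore] -/
theorem complexToEuclidean_eq (n : ℕ) :
    Motives.complexToEuclidean n = (complexToEuclideanCLE n).toHomeomorph := rfl

/-- **The changes of holomorphic algebraic charts are holomorphic**: for complex points `P`, `P'` of a
scheme smooth of relative dimension `n` and locally of finite type over `ℂ`, the transition
`a_P ∘ a_{P'}⁻¹` between the algebraic charts is `ℂ`-differentiable at `a_{P'} y` for every `y` in both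
sources (the coordinates of `a_P` are regular functions, holomorphic in the chart `a_{P'}`; Serre, GAGA
§2 n°5 Prop. 2 — the tree's `Motives.ComplexPoints.algebraicChart_spec`). [cite: SerreGAGA1956, §2 n°5 Prop. 2] -/
theorem differentiableAt_algebraicChart_transition [LocallyOfFiniteType X.hom]
    [SmoothOfRelativeDimension n X.hom] (P P' : Motives.ComplexPoints X) {y : Motives.ComplexPoints X}
    (hy : y ∈ (Motives.ComplexPoints.algebraicChart X n P).source)
    (hy' : y ∈ (Motives.ComplexPoints.algebraicChart X n P').source) :
    DifferentiableAt ℂ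
      (fun v ↦ Motives.ComplexPoints.algebraicChart X n P ((Motives.ComplexPoints.algebraicChart X n P').symm v))
      (Motives.ComplexPoints.algebraicChart X n P' y) := by
  set a := Motives.ComplexPoints.algebraicChart X n P with ha
  set a' := Motives.ComplexPoints.algebraicChart X n P' with ha'
  obtain ⟨⟨U, x, hsrc, hx⟩, -⟩ := Motives.ComplexPoints.algebraicChart_spec X n P
  obtain ⟨-, hol'⟩ := Motives.ComplexPoints.algebraicChart_spec X n P'
  -- holomorphy of the transition on the open `a'.target ∩ a'⁻¹(a.source)`
  have hol : ContDiffOn ℂ ω (fun v ↦ a (a'.symm v)) (a'.target ∩ a'.symm ⁻¹' a.source) := by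
    refine contDiffOn_pi' fun i ↦ ?_
    refine ((hol' U (x i)).mono ?_).congr ?_
    · rintro w ⟨hw, hw'⟩
      exact ⟨hw, hsrc hw'⟩
    · rintro w ⟨-, hw'⟩
      exact hx _ hw' i
  have hopen : IsOpen (a'.target ∩ a'.symm ⁻¹' a.source) := a'.isOpen_inter_preimage_symm a.open_source
  have hmem : a' y ∈ a'.target ∩ a'.symm ⁻¹' a.source :=
    ⟨a'.map_source hy', by rw [mem_preimage, a'.left_inv hy']; exact hy⟩
  exact (hol.differentiableOn (by simp)).differentiableAt (hopen.mem_nhds hmem)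

/-- **The atlas of holomorphic algebraic charts of `X(ℂ)` is a positive atlas** (`X` smooth projective
of dimension `n`, atlas `IsSmoothProjective.chartedSpace`): every change of charts is, in the fixed
real coordinates `ℂⁿ ≃ ℝ²ⁿ`, the realification of a holomorphic map with invertible complex differential
`A` (the reverse change inverts it near the point), whose real Jacobian determinant is
`det_ℝ A = |det_ℂ A|² > 0` ("every complex manifold has a preferred orientation"; Huybrechts
Cor. 1.2.3). [cite: MilnorStasheff1974, §13 p. 151] [cite: HuybrechtsCG2005, Cor. 1.2.3] -/
theorem isPositiveAtlas_complexPoints (hX : Motives.IsSmoothProjective n X) :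
    @IsPositiveAtlas (2 * n) (Motives.ComplexPoints X) _ hX.chartedSpace := by
  haveI : IsProper X.hom := Motives.IsSmoothProjective.isProper_holds hX
  haveI := hX.smoothOfRelativeDimension
  letI := hX.chartedSpace
  rintro c ⟨P, rfl⟩ c' ⟨P', rfl⟩ y ⟨hy, hy'⟩
  set a := Motives.ComplexPoints.algebraicChart X n P with ha
  set a' := Motives.ComplexPoints.algebraicChart X n P' with ha'
  set L := complexToEuclideanCLE n with hL
  rw [OpenPartialHomeomorph.transHomeomorph_source] at hy hy'
  -- the complex transition maps and their differentials
  set T : (Fin n → ℂ) → (Fin n → ℂ) := fun v ↦ a (a'.symm v) with hT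
  set T' : (Fin n → ℂ) → (Fin n → ℂ) := fun u ↦ a' (a.symm u) with hT'
  set v₀ : Fin n → ℂ := a' y with hv₀
  have hTv₀ : T v₀ = a y := by simp only [hT, hv₀, a'.left_inv hy']
  have HT : DifferentiableAt ℂ T v₀ := differentiableAt_algebraicChart_transition P P' hy hy'
  have HT' : DifferentiableAt ℂ T' (a y) := differentiableAt_algebraicChart_transition P' P hy' hy
  set A := fderiv ℂ T v₀ with hA
  set A' := fderiv ℂ T' (a y) with hA'
  -- `T' ∘ T = id` near `v₀`, hence `A' ∘ A = id` and `det A ≠ 0`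
  have hev : (fun v ↦ T' (T v)) =ᶠ[𝓝 v₀] id := by
    have hS : IsOpen (a'.target ∩ a'.symm ⁻¹' a.source) := a'.isOpen_inter_preimage_symm a.open_source
    have hv₀S : v₀ ∈ a'.target ∩ a'.symm ⁻¹' a.source :=
      ⟨a'.map_source hy', by rw [mem_preimage, hv₀, a'.left_inv hy']; exact hy⟩
    filter_upwards [hS.mem_nhds hv₀S] with v hv
    simp only [hT, hT', id, a.left_inv hv.2, a'.right_inv hv.1]
  have hcomp : HasFDerivAt (fun v ↦ T' (T v)) (A'.comp A) v₀ := by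
    have h2 : HasFDerivAt T' A' (T v₀) := by rw [hTv₀]; exact HT'.hasFDerivAt
    exact h2.comp v₀ HT.hasFDerivAt
  have hid : HasFDerivAt (fun v ↦ T' (T v)) (ContinuousLinearMap.id ℂ _) v₀ :=
    (hasFDerivAt_id v₀).congr_of_eventuallyEq hev
  have hAA : A'.comp A = ContinuousLinearMap.id ℂ _ := hcomp.unique hid
  have hdetA : LinearMap.det (A : (Fin n → ℂ) →ₗ[ℂ] (Fin n → ℂ)) ≠ 0 := by
    intro h0
    have h1 : LinearMap.det ((A'.comp A : (Fin n → ℂ) →L[ℂ] (Fin n → ℂ)) :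
        (Fin n → ℂ) →ₗ[ℂ] (Fin n → ℂ)) =
        LinearMap.det (A' : (Fin n → ℂ) →ₗ[ℂ] (Fin n → ℂ)) *
          LinearMap.det (A : (Fin n → ℂ) →ₗ[ℂ] (Fin n → ℂ)) := by
      rw [show ((A'.comp A : (Fin n → ℂ) →L[ℂ] (Fin n → ℂ)) : (Fin n → ℂ) →ₗ[ℂ] (Fin n → ℂ)) =
        (A' : (Fin n → ℂ) →ₗ[ℂ] (Fin n → ℂ)).comp (A : (Fin n → ℂ) →ₗ[ℂ] (Fin n → ℂ)) from rfl,
        LinearMap.det_comp]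
    rw [hAA, h0, mul_zero] at h1
    exact one_ne_zero (LinearMap.det_id.symm.trans h1)
  -- the real transition map is `L ∘ T ∘ L⁻¹`
  have hreal : (fun x ↦ (a.transHomeomorph (Motives.complexToEuclidean n))
      ((a'.transHomeomorph (Motives.complexToEuclidean n)).symm x)) = fun x ↦ L (T (L.symm x)) := by
    funext x
    rfl
  have hderiv : HasFDerivAt (fun x ↦ (a.transHomeomorph (Motives.complexToEuclidean n))
      ((a'.transHomeomorph (Motives.complexToEuclidean n)).symm x))
      ((L : (Fin n → ℂ) →L[ℝ] _).comp ((A.restrictScalars ℝ).comp (L.symm : _ →L[ℝ] (Fin n → ℂ))))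
      ((a'.transHomeomorph (Motives.complexToEuclidean n)) y) := by
    rw [hreal]
    have hy₀ : (a'.transHomeomorph (Motives.complexToEuclidean n)) y = L v₀ := rfl
    rw [hy₀]
    have h1 : HasFDerivAt (fun x ↦ L.symm x) (L.symm : _ →L[ℝ] (Fin n → ℂ)) (L v₀) := L.symm.hasFDerivAt
    have h2 : HasFDerivAt T (A.restrictScalars ℝ) (L.symm (L v₀)) := by
      rw [L.symm_apply_apply]
      exact HT.hasFDerivAt.restrictScalars ℝ
    have h3 : HasFDerivAt (fun u ↦ L u) (L : (Fin n → ℂ) →L[ℝ] _) (T (L.symm (L v₀))) := L.hasFDerivAt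
    exact h3.comp (L v₀) (h2.comp (L v₀) h1)
  refine ⟨_, hderiv, ?_⟩
  rw [det_conj_continuousLinearEquiv]
  have hrs : ((A.restrictScalars ℝ : (Fin n → ℂ) →L[ℝ] (Fin n → ℂ)) : (Fin n → ℂ) →ₗ[ℝ] (Fin n → ℂ)) =
      (A : (Fin n → ℂ) →ₗ[ℂ] (Fin n → ℂ)).restrictScalars ℝ := rfl
  rw [hrs, det_restrictScalars_eq_normSq]
  exact Complex.normSq_pos.2 hdetA

/-! ### The complex orientation -/

/-- A fixed generator of `H_d(ℝᵈ | 0; ℤ)` for every `d` (a `ℤ`-orientation of `ℝᵈ`, which is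
simply connected; `nonempty_homologicalOrientation_euclidean`) — the sign convention of the complex
orientations below. [cite: HatcherAT2002, §3.3 Prop. 3.25] -/
def euclideanGenerator (d : ℕ) : HomologicalOrientation ℤ (EuclideanSpace ℝ (Fin d)) d :=
  Classical.choice (nonempty_homologicalOrientation_euclidean d)

/-- **The complex orientation of `X(ℂ)`** for `X` smooth projective of dimension `n`: the
`ℤ`-orientation of the closed `2n`-manifold `X(ℂ)` defined by its positive atlas of holomorphic
algebraic charts (`positiveAtlasOrientation`, Bredon VI.7 / Milnor–Stasheff App. A: the reference
classes `(chart)^* g` of a positive atlas form a locally consistent family of generators), relative to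
the fixed generator `euclideanGenerator (2n)` — "a complex manifold is canonically oriented" (Voisin I
§11.1.2), up to a sign depending only on `n`. [cite: MilnorStasheff1974, §13 p. 151 and Appendix A]
[cite: Bredon1993, VI.7] [cite: VoisinHodgeI2002, §11.1.2] -/
def complexOrientationInt (hX : Motives.IsSmoothProjective n X) :
    HomologicalOrientation ℤ (Motives.ComplexPoints X) (2 * n) :=
  letI := hX.chartedSpace
  haveI := Motives.ComplexPoints.t2Space_of_isSmoothProjective hX
  positiveAtlasOrientation (isPositiveAtlas_complexPoints hX) (euclideanGenerator (2 * n))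

/-- The local classes of the complex orientation are the reference classes of the algebraic charts:
at `y`, the generator `euclideanGenerator (2n)` pulled back along the chart of the atlas at `y`.
[cite: Bredon1993, VI.7] -/
theorem complexOrientationInt_localClass (hX : Motives.IsSmoothProjective n X)
    (y : Motives.ComplexPoints X) :
    (complexOrientationInt hX).localClass y =
      letI := hX.chartedSpace
      haveI := Motives.ComplexPoints.t2Space_of_isSmoothProjective hX
      chartRefFamily (euclideanGenerator (2 * n)) y :=
  rfl

/-- **The rational complex orientation** `x ↦ μₓ ⊗ 1` of `X(ℂ)` (Hatcher p. 235: an orientable manifold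
is `R`-orientable for all `R`; the tree's `HomologicalOrientation.toCoeff`). [cite: HatcherAT2002, §3.3 p. 235] -/
def complexOrientationRat (hX : Motives.IsSmoothProjective n X) :
    HomologicalOrientation ℚ (Motives.ComplexPoints X) (2 * n) :=
  letI := hX.chartedSpace
  haveI := Motives.ComplexPoints.t2Space_of_isSmoothProjective hX
  (complexOrientationInt hX).toCoeff ℚ

/-- An auxiliary `ℂ`-orientation of `X(ℂ)`: `x ↦ μₓ ⊗ 1` for the complex orientation (to be rescaled so
that its fundamental class is literally the complexified rational one). [cite: HatcherAT2002, §3.3 p. 235] -/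
def complexOrientationAux (hX : Motives.IsSmoothProjective n X) :
    HomologicalOrientation ℂ (Motives.ComplexPoints X) (2 * n) :=
  letI := hX.chartedSpace
  haveI := Motives.ComplexPoints.t2Space_of_isSmoothProjective hX
  (complexOrientationInt hX).toCoeff ℂ

/-- The scalar `c ≠ 0` with `ι_*[X(ℂ)]_ℚ = c • [X(ℂ)]_{aux}` (two `ℂ`-fundamental classes of the closed
connected `X(ℂ)` are proportional, Hatcher Thm. 3.26; `exists_coeffChange_fundamentalClass_eq_smul`).
[cite: HatcherAT2002, §3.3 Thm. 3.26] -/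
theorem exists_complexOrientationScalar (hX : Motives.IsSmoothProjective n X) :
    ∃ c : ℂ, c ≠ 0 ∧
      singularHomology.coeffChange (Motives.ComplexPoints X) (algebraMap ℚ ℂ).toAddMonoidHom (2 * n)
        (complexOrientationRat hX).fundamentalClass = c • (complexOrientationAux hX).fundamentalClass :=
  exists_coeffChange_fundamentalClass_eq_smul (fun _ _ h ↦ complexOrientationAux h) hX
    (complexOrientationRat hX)

/-- **The complex orientation family**: for every smooth projective `X`, the `ℂ`-orientation of `X(ℂ)`
whose fundamental class is the complexified rational complex fundamental class `ι_*[X(ℂ)]`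
(`fundamentalClass_complexOrientationFamily`) — the complex orientation with `ℂ`-coefficients (an
orientation of the closed connected `X(ℂ)` over a field is determined by its fundamental class), built by
rescaling `complexOrientationAux` by the scalar of `exists_complexOrientationScalar`.
[cite: VoisinHodgeI2002, §11.1.2 and §7.3.2] [cite: HatcherAT2002, §3.3 Thm. 3.26] -/
def complexOrientationFamily : OrientationFamily := fun _ _ hX ↦
  (complexOrientationAux hX).unitSmul
    (Units.mk0 (exists_complexOrientationScalar hX).choose (exists_complexOrientationScalar hX).choose_spec.1)

/-- **`[X(ℂ)] = ι_*[X(ℂ)]_ℚ`**: the fundamental class of the complex orientation family is the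
complexification of the fundamental class of the rational complex orientation.
[cite: VoisinHodgeI2002, §7.3.2] [cite: HatcherAT2002, §3.3 Thm. 3.26] -/
theorem fundamentalClass_complexOrientationFamily (hX : Motives.IsSmoothProjective n X) :
    (complexOrientationFamily hX).fundamentalClass =
      singularHomology.coeffChange (Motives.ComplexPoints X) (algebraMap ℚ ℂ).toAddMonoidHom (2 * n)
        (complexOrientationRat hX).fundamentalClass := by
  letI := hX.chartedSpace
  haveI := Motives.ComplexPoints.compactSpace_of_isSmoothProjective hX
  haveI := Motives.ComplexPoints.t2Space_of_isSmoothProjective hX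
  haveI := connectedSpace_complexPoints hX
  change ((complexOrientationAux hX).unitSmul _).fundamentalClass = _
  rw [HomologicalOrientation.fundamentalClass_unitSmul, Units.val_mk0]
  exact (exists_complexOrientationScalar hX).choose_spec.2.symm

/-- **The complex orientation family has rational fundamental classes** (the hypothesis
`OrientationFamily.HasRationalFundamentalClasses` of `HodgeTheory/CycleClassOfResolutions`, in its
unfolded form): `[X(ℂ)]` is `ι_*` of the fundamental class of a `ℚ`-orientation. Hence the Gysin
morphisms `complexGysin complexOrientationFamily` preserve rational classes.
[cite: VoisinHodgeI2002, §7.3.2] -/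
theorem exists_coeffChange_fundamentalClass_eq_complexOrientationFamily
    (hX : Motives.IsSmoothProjective n X) :
    ∃ ν : HomologicalOrientation ℚ (Motives.ComplexPoints X) (2 * n),
      singularHomology.coeffChange (Motives.ComplexPoints X) (algebraMap ℚ ℂ).toAddMonoidHom (2 * n)
        ν.fundamentalClass = (complexOrientationFamily hX).fundamentalClass :=
  ⟨complexOrientationRat hX, (fundamentalClass_complexOrientationFamily hX).symm⟩

/-- The complex orientation family satisfies Poincaré duality (as every orientation family does,
Hatcher Thm. 3.30). [cite: HatcherAT2002, §3.3 Thm. 3.30] -/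
theorem hasPoincareDuality_complexOrientationFamily : complexOrientationFamily.HasPoincareDuality :=
  OrientationFamily.hasPoincareDuality_of (fun ν _ _ h ↦ poincare_duality ν h) _

end HodgeTheory

end Literature.AlgebraicGeometry.HodgeTheory

end
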